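import Mathlib
import HarnessLib
import Literature.Analysis.FluidPDE.VectorCalculusProofs
import Summits.NavierStokesRegularity.NavierStokesRegularity.Theorems.TypeIQuarterGateScarEnvelopeTypeIForcedTsaiAlgCalculus
import Summits.NavierStokesRegularity.NavierStokesRegularity.Theorems.TypeIQuarterGateScarEnvelopeTypeIForcedTsaiAlgMoments

/-!
# ARM B lane E-exact, Type-I-tail class — SOUNDNESS of the witness rows:
  `AlgRow.check = true → ForcedTsaiModulusLE M δ`

The kernel soundness theorem of the tree checker `…ForcedTsaiAlgCert` (LANEX-ALG): a passing `AlgRow`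
CERTIFIES `ForcedTsaiModulusLE M δ` — there is an explicit smooth divergence-free field (the witness
`U = curl Ψ = evalVec5 τ u`, polynomial × algebraic-kernel class with Type-I tails) with
`‖curl U‖_{L²(B₁₀)} ≥ M` whose weighted vorticity residual `‖(1+ρ)^{5/2} g‖_{L²(ℝ³)}` of the steady
backward Leray operator is `≤ δ`.  Assembled from `…AlgSemantics` (values, normal form, the two weights),
`…AlgCalculus` (`curl U = evalVec5 ω`, `g = evalVec5 (curl5 lin5 + curl5 conv5)`), `…AlgMoments`
(`Poly5.integrate` = the `ℝ³` integral, with integrability), the tree fact `div curl = 0`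
(`Literature…divergence_curl_eq_zero_holds`) and the glue below (level via `φ ≤ 𝟙_{B₁₀}`, residual via
the even AM-GM majorant `(1+ρ)⁵ ≤ m`, termwise-signed enclosure of `π`, `π²`).

MEANING (fixed by the exp-lead for RESULTS-WALL-1): an UPPER bound on the forced-Tsai modulus — «near-
profiles with residual this small EXIST»; never an exclusion.  Nothing here bears on NS regularity;
crux `ScarEnvelopeTypeI` (stmt-23843) and wall H3 are OPEN.
-/

noncomputable section

set_option linter.dupNamespace false

namespace Summit.NavierStokesRegularity.NavierStokesRegularity.Cruxes.ScarEnvelopeTypeI.ForcedTsai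

open MeasureTheory Set Metric Real
open scoped RealInnerProductSpace ContDiff
open Literature.Analysis.FluidPDE

/-! ## The enclosure of `π` -/

/-- `piLo ≤ π ≤ piHi`. -/
theorem pi_mem_enclosure : (piLo : ℝ) ≤ π ∧ π ≤ (piHi : ℝ) := by
  constructor
  · have := Real.pi_gt_d20; norm_num [piLo] at this ⊢; linarith
  · have := Real.pi_lt_d20; norm_num [piHi] at this ⊢; linarith

/-- First enclosure term, lower. -/
theorem enc1_lo (c1 : ℚ) : ((if 0 ≤ c1 then c1 * piLo else c1 * piHi : ℚ) : ℝ) ≤ (c1 : ℝ) * π := by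
  obtain ⟨hlo, hhi⟩ := pi_mem_enclosure
  split_ifs with h
  · push_cast; exact mul_le_mul_of_nonneg_left hlo (show (0 : ℝ) ≤ (c1 : ℝ) by exact_mod_cast h)
  · push_cast; push Not at h
    exact mul_le_mul_of_nonpos_left hhi (show (c1 : ℝ) ≤ 0 by exact_mod_cast h.le)

/-- Second enclosure term, lower. -/
theorem enc2_lo (c2 : ℚ) : ((if 0 ≤ c2 then c2 * piLo ^ 2 else c2 * piHi ^ 2 : ℚ) : ℝ) ≤ (c2 : ℝ) * π ^ 2 := by
  obtain ⟨hlo, hhi⟩ := pi_mem_enclosure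
  have hlo0 : (0 : ℝ) ≤ piLo := by norm_num [piLo]
  split_ifs with h
  · push_cast
    exact mul_le_mul_of_nonneg_left (pow_le_pow_left₀ hlo0 hlo 2) (show (0 : ℝ) ≤ (c2 : ℝ) by exact_mod_cast h)
  · push_cast; push Not at h
    exact mul_le_mul_of_nonpos_left (pow_le_pow_left₀ Real.pi_pos.le hhi 2) (show (c2 : ℝ) ≤ 0 by exact_mod_cast h.le)

/-- First enclosure term, upper. -/
theorem enc1_hi (c1 : ℚ) : (c1 : ℝ) * π ≤ ((if 0 ≤ c1 then c1 * piHi else c1 * piLo : ℚ) : ℝ) := by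
  obtain ⟨hlo, hhi⟩ := pi_mem_enclosure
  split_ifs with h
  · push_cast; exact mul_le_mul_of_nonneg_left hhi (show (0 : ℝ) ≤ (c1 : ℝ) by exact_mod_cast h)
  · push_cast; push Not at h
    exact mul_le_mul_of_nonpos_left hlo (show (c1 : ℝ) ≤ 0 by exact_mod_cast h.le)

/-- Second enclosure term, upper. -/
theorem enc2_hi (c2 : ℚ) : (c2 : ℝ) * π ^ 2 ≤ ((if 0 ≤ c2 then c2 * piHi ^ 2 else c2 * piLo ^ 2 : ℚ) : ℝ) := by
  obtain ⟨hlo, hhi⟩ := pi_mem_enclosure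
  have hlo0 : (0 : ℝ) ≤ piLo := by norm_num [piLo]
  split_ifs with h
  · push_cast
    exact mul_le_mul_of_nonneg_left (pow_le_pow_left₀ Real.pi_pos.le hhi 2) (show (0 : ℝ) ≤ (c2 : ℝ) by exact_mod_cast h)
  · push_cast; push Not at h
    exact mul_le_mul_of_nonpos_left (pow_le_pow_left₀ hlo0 hlo 2) (show (c2 : ℝ) ≤ 0 by exact_mod_cast h.le)

/-- `encLo` is a lower bound of `c₁π + c₂π²`. -/
theorem encLo_le (c : ℚ × ℚ) : (encLo c : ℝ) ≤ (c.1 : ℝ) * π + (c.2 : ℝ) * π ^ 2 := by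
  rw [encLo, Rat.cast_add]; exact add_le_add (enc1_lo c.1) (enc2_lo c.2)

/-- `encHi` is an upper bound of `c₁π + c₂π²`. -/
theorem le_encHi (c : ℚ × ℚ) : (c.1 : ℝ) * π + (c.2 : ℝ) * π ^ 2 ≤ (encHi c : ℝ) := by
  rw [encHi, Rat.cast_add]; exact add_le_add (enc1_hi c.1) (enc2_hi c.2)

/-! ## The witness field of a row -/

namespace AlgRow

/-- The witness is the curl of the symbolic vector potential. -/
theorem field_eq_curl (r : AlgRow) : r.field = curl (evalVec5 r.tauR r.psi) := by
  funext y; rw [field, AlgRow.u, curl_evalVec5 r.cast_tau2]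

/-- The witness field is smooth. -/
theorem contDiff_field (r : AlgRow) : ContDiff ℝ ∞ r.field := contDiff_evalVec5 _ _

/-- The witness field is divergence-free (`div curl = 0`). -/
theorem isDivFree_field (r : AlgRow) : VectorCalculus.IsDivFree r.field := by
  intro y
  rw [field_eq_curl]
  exact divergence_curl_eq_zero_holds _ (contDiff_evalVec5 _ _) y

/-- `curl U = evalVec5 ω`. -/
theorem curl_field (r : AlgRow) (y : E3) : curl r.field y = evalVec5 r.tauR r.om y := by
  rw [field, AlgRow.om, curl_evalVec5 r.cast_tau2]

/-- The vorticity residual of the witness is `evalVec5 g`. -/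
theorem vorticityResidual_field (r : AlgRow) (y : E3) :
    lerayVorticityResidual r.field y = evalVec5 r.tauR r.g y := by
  rw [field, vorticityResidual_evalVec5 r.cast_tau2]; rfl

/-- … and also `evalVec5 gNF` (the normal form is value-preserving; `τ ≠ 0`). -/
theorem vorticityResidual_field_nf (r : AlgRow) (hτ : r.tauR ≠ 0) (y : E3) :
    lerayVorticityResidual r.field y = evalVec5 r.tauR r.gNF y := by
  rw [r.vorticityResidual_field y]
  ext i
  simp only [evalVec5_apply, AlgRow.gNF, Poly5.eval_norm, Poly5.eval_nf hτ r.cast_tau2]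

/-- `‖V‖² = ⟪V,V⟫` for symbolic fields, as the value of the symbolic sum of squares. -/
theorem norm_sq_evalVec5 (τ : ℝ) (V : Fin 3 → Poly5) (y : E3) :
    ‖evalVec5 τ V y‖ ^ 2 =
      Poly5.eval τ (Poly5.add (Poly5.add (Poly5.nmul (V 0) (V 0)) (Poly5.nmul (V 1) (V 1))) (Poly5.nmul (V 2) (V 2))) y := by
  rw [← real_inner_self_eq_norm_sq, inner_evalVec5]

/-- Value of the level integrand: `φ(y)·‖curl U(y)‖²`. -/
theorem eval_levPoly (r : AlgRow) (y : E3) :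
    Poly5.eval r.tauR r.levPoly y = Poly5.eval r.tauR (floorPoly r.tau2 r.mF r.kF) y * ‖curl r.field y‖ ^ 2 := by
  rw [AlgRow.levPoly, Poly5.eval_nmul, r.curl_field y, norm_sq_evalVec5]

/-- Value of the residual integrand: `m(y)·‖g(y)‖²` (`τ ≠ 0`). -/
theorem eval_resPoly (r : AlgRow) (hτ : r.tauR ≠ 0) (y : E3) :
    Poly5.eval r.tauR r.resPoly y = Poly5.eval r.tauR (majorPoly r.r1 r.r3 r.r5) y * ‖lerayVorticityResidual r.field y‖ ^ 2 := by
  rw [AlgRow.resPoly, Poly5.eval_nmul, r.vorticityResidual_field_nf hτ y, norm_sq_evalVec5]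

end AlgRow

/-! ## The soundness theorem -/

/-- **SOUNDNESS of a Type-I-tail E-exact witness row**: a passing row certifies
`ForcedTsaiModulusLE M δ` — an upper bound on the forced-Tsai modulus. -/
theorem AlgRow.sound (r : AlgRow) (h : r.check = true) :
    ForcedTsaiModulusLE (r.M : ℝ) (r.δ : ℝ) := by
  unfold AlgRow.check at h
  -- peel the match on the two integrals
  rcases hL : r.lev2 with _ | L <;> rcases hR : r.res2 with _ | R <;> simp only [hL, hR, Bool.and_false,
    Bool.and_eq_true, decide_eq_true_eq] at h
  · exact absurd h (by simp)
  · exact absurd h (by simp)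
  · exact absurd h (by simp)
  obtain ⟨⟨⟨⟨⟨⟨⟨hτ, hr1⟩, hr3⟩, hr5⟩, -⟩, hM⟩, hδ⟩, hlev, hres⟩ := h
  have hτR : 0 < r.tauR := by unfold AlgRow.tauR; exact_mod_cast hτ
  have hτ0 : r.tauR ≠ 0 := hτR.ne'
  have hM' : (0 : ℝ) ≤ r.M := by exact_mod_cast hM
  have hδ' : (0 : ℝ) ≤ r.δ := by exact_mod_cast hδ
  -- the two moment packages
  obtain ⟨hintL, hIL⟩ := integral_poly5 hτ r.levPoly (c := L) hL
  obtain ⟨hintR, hIR⟩ := integral_poly5 hτ r.resPoly (c := R) hR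
  have hτcast : ((r.tau : ℚ) : ℝ) = r.tauR := rfl
  rw [hτcast] at hintL hIL hintR hIR
  refine ⟨r.field, r.contDiff_field, r.isDivFree_field, ?_, ?_, ?_⟩
  · -- LEVEL: M² ≤ encLo L ≤ ∫ φ‖curl U‖² ≤ ∫_{B₁₀} ‖curl U‖²
    unfold lerayLevel
    refine (Real.le_sqrt hM' (integral_nonneg fun y => sq_nonneg _)).mpr ?_
    have hind : IntegrableOn (fun y => ‖curl r.field y‖ ^ 2) (ball (0 : E3) 10) := by
      have hc : Continuous fun y => ‖curl r.field y‖ ^ 2 := by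
        have : (fun y => ‖curl r.field y‖ ^ 2) = fun y => ‖evalVec5 r.tauR r.om y‖ ^ 2 :=
          funext fun y => by rw [r.curl_field y]
        rw [this]; exact (continuous_evalVec5 _ _).norm.pow 2
      exact (hc.continuousOn.integrableOn_compact (isCompact_closedBall (0 : E3) 10)).mono_set ball_subset_closedBall
    have hmono : ∫ y, Poly5.eval r.tauR r.levPoly y ≤ ∫ y in ball (0 : E3) 10, ‖curl r.field y‖ ^ 2 := by
      rw [← integral_indicator measurableSet_ball]
      refine integral_mono hintL (hind.integrable_indicator measurableSet_ball) fun y => ?_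
      beta_reduce
      rw [r.eval_levPoly y]
      have key := floorPoly_mul_le hτ0 r.cast_tau2 r.mF r.kF y (sq_nonneg ‖curl r.field y‖)
      refine key.trans (le_of_eq ?_)
      by_cases hy : y ∈ ball (0 : E3) 10
      · rw [indicator_of_mem hy, indicator_of_mem hy, one_mul]
      · rw [indicator_of_notMem hy, indicator_of_notMem hy, zero_mul]
    have hlev' : (r.M : ℝ) ^ 2 ≤ (encLo L : ℝ) := by
      have := hlev; rw [← sq] at this; exact_mod_cast this
    calc (r.M : ℝ) ^ 2 ≤ (encLo L : ℝ) := hlev'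
      _ ≤ (L.1 : ℝ) * π + (L.2 : ℝ) * π ^ 2 := encLo_le L
      _ = ∫ y, Poly5.eval r.tauR r.levPoly y := hIL.symm
      _ ≤ ∫ y in ball (0 : E3) 10, ‖curl r.field y‖ ^ 2 := hmono
  · -- INTEGRABILITY of (1+ρ)⁵ |g|² by domination with m·|g|²
    refine hintR.mono' ?_ (Filter.Eventually.of_forall fun y => ?_)
    · have hc : Continuous fun y => (1 + ‖y‖) ^ 5 * ‖lerayVorticityResidual r.field y‖ ^ 2 := by
        have : (fun y => (1 + ‖y‖) ^ 5 * ‖lerayVorticityResidual r.field y‖ ^ 2) = fun y =>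
            (1 + ‖y‖) ^ 5 * ‖evalVec5 r.tauR r.g y‖ ^ 2 := by
          funext y; rw [r.vorticityResidual_field y]
        rw [this]
        exact ((continuous_const.add continuous_norm).pow 5).mul ((continuous_evalVec5 _ _).norm.pow 2)
      exact hc.aestronglyMeasurable
    · rw [Real.norm_eq_abs, abs_of_nonneg (by positivity), r.eval_resPoly hτ0 y]
      exact mul_le_mul_of_nonneg_right (pow_five_le_majorPoly r.tauR hr1 hr3 hr5 y) (sq_nonneg _)
  · -- RESIDUAL: ∫ (1+ρ)⁵|g|² ≤ ∫ m|g|² = R₁π + R₂π² ≤ encHi R ≤ δ²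
    unfold lerayResidualNorm
    rw [show (r.δ : ℝ) = Real.sqrt ((r.δ : ℝ) ^ 2) by rw [Real.sqrt_sq hδ']]
    refine Real.sqrt_le_sqrt ?_
    have hstep : ∫ y, (1 + ‖y‖) ^ 5 * ‖lerayVorticityResidual r.field y‖ ^ 2 ≤ ∫ y, Poly5.eval r.tauR r.resPoly y := by
      refine integral_mono_of_nonneg (Filter.Eventually.of_forall fun y => by positivity) hintR
        (Filter.Eventually.of_forall fun y => ?_)
      beta_reduce
      rw [r.eval_resPoly hτ0 y]
      exact mul_le_mul_of_nonneg_right (pow_five_le_majorPoly r.tauR hr1 hr3 hr5 y) (sq_nonneg _)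
    have hres' : (encHi R : ℝ) ≤ (r.δ : ℝ) ^ 2 := by
      have := hres; rw [← sq] at this; exact_mod_cast this
    calc ∫ y, (1 + ‖y‖) ^ 5 * ‖lerayVorticityResidual r.field y‖ ^ 2
        ≤ ∫ y, Poly5.eval r.tauR r.resPoly y := hstep
      _ = (R.1 : ℝ) * π + (R.2 : ℝ) * π ^ 2 := hIR
      _ ≤ (encHi R : ℝ) := le_encHi R
      _ ≤ (r.δ : ℝ) ^ 2 := hres'

/-- **Table soundness**: every row of a passing table certifies its `ForcedTsaiModulusLE M δ`. -/
theorem AlgTable.sound (T : AlgTable) (h : T.check = true) :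
    ∀ r ∈ T, ForcedTsaiModulusLE (r.M : ℝ) (r.δ : ℝ) := by
  intro r hr
  unfold AlgTable.check at h
  rw [List.all_eq_true] at h
  exact r.sound (h r hr)

end Summit.NavierStokesRegularity.NavierStokesRegularity.Cruxes.ScarEnvelopeTypeI.ForcedTsai

end
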